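import Summits.NavierStokesRegularity.FluidComputer.LeraySupClock
import Summits.NavierStokesRegularity.FluidComputer.LerayClock
import HarnessLib

/-!
# Fluid computer — the TIME FACE of the level dictionary, VII: the DOUBLING TIME of the maximum speed (L25)

HONEST FRAMING (cell `pub-fluidc`, verbatim): *low prior, high value-of-information experiment on Tao's
machine paradigm; NOT a claim that NS blows up.* Theorem side of the cell; nothing here is evidence of blow-up.
The speed limit in the AMPLITUDE currency (companion of `LeraySupClock.supNorm_clock`, L21, which it implies by
iteration, and of the enstrophy speed limit `LeraySpeedLimit.speed_limit`, L24): Leray's a priori bound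
(1934, §21, (3.14)–(3.15); Ożański–Pooley 2018, Lemma 6.23 (i)), proved in the tree as
`exists_norm_le_two_mul_of_window` for bounded classical Leray–Hopf solutions on closed slabs, transported to the
dictionary's class:

* `sup_doubling_time` (**L25, THE DOUBLING-TIME FLOOR**) — an absolute `C > 0` such that along every maximal
  smooth solution `(u, p)` of the unforced Navier–Stokes system on `ℝ³ × [0, T)` (`ν > 0`, Leray–Hopf from `u 0`),
  for every `a ∈ (0, T)` and every `V > 0` with `‖u(a, ·)‖ ≤ V` pointwise: `‖u(t, x)‖ ≤ 2V` for all `x` and all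
  `t ∈ [a, T)` with `C V² (t − a) < ν` — THE MAXIMUM SPEED NEEDS AT LEAST `ν/(C V²)` TO DOUBLE. (Restart at `a`:
  the translate is classical on `[0, t − a]`, Leray–Hopf from `u(a)` (`LerayClock.isLerayHopfOn_translate`) and
  bounded there (`LeraySupClock.exists_bound_window`).)
* `sup_doubling_time_eLpNorm` — the same with `V = ‖u(a)‖_∞` read off the essential supremum
  (`‖u(a, y)‖ ≤ ‖u(a)‖_∞` pointwise for the continuous slice).

In the machine's words: however a hand-off is engineered, the sup-amplitude of the flow cannot double faster
than `ν/(C V²)` at amplitude `V` — iterating, `k` doublings from `V` take at least `(ν/(C V²))(1 − 4^{−k})·(4/3)`,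
which is the sup clock `T − t ≳ ν/V²` (L21) again. HONEST SIZE NOTE: `C` inexplicit (`64 C₁²`, `C₁` the
Oseen-kernel constant); the floor carries `ν¹` — the least small of the dictionary's clocks (`ν ≈ 3.3·10⁻³` at
`ρ = 3`), still words, not numbers. Necessity only. 0 sorry; no new definitions, no named facts.

## References

* J. Leray, Acta Math. 63 (1934) 193–248, §21 (3.14)–(3.15), §19 (3.8). [Leray1934]
* W. S. Ożański, B. C. Pooley, in: *PDEs in Fluid Mechanics*, LMS Lect. Note Ser. 452 (2018), Lemma 6.23 (i).
  [OzanskiPooley2018]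
-/

noncomputable section

open MeasureTheory Set Function Filter Topology Metric
open scoped ENNReal NNReal
open Literature.Analysis.FluidPDE Literature.Analysis.FunctionSpaces
open Summit.NavierStokesRegularity.FluidComputer.LerayClock
open Summit.NavierStokesRegularity.FluidComputer.LeraySupClock

namespace Summit.NavierStokesRegularity.FluidComputer.LeraySupDoubling

/-- **L25 — THE DOUBLING-TIME FLOOR FOR THE MAXIMUM SPEED.** There is an absolute `C > 0` such that for every
`ν > 0`, `T > 0`, every maximal smooth solution `(u, p)` of the unforced Navier–Stokes system on `ℝ³ × [0, T)`
which is Leray–Hopf from `u 0`, every `a ∈ (0, T)` and every `V > 0` with `‖u(a, y)‖ ≤ V` for all `y`: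
for all `t ∈ [a, T)` with `C V² (t − a) < ν` and all `x`, `‖u(t, x)‖ ≤ 2 V` — the sup-amplitude cannot double in
less than `ν/(C V²)` (Leray 1934, (3.14)–(3.15), `τ = A ν V⁻²`). [cite: Leray1934, §21 (3.14)–(3.15) p. 226]
[cite: OzanskiPooley2018, Lemma 6.23 (i) with (6.65) and Lemma 6.5] -/
theorem sup_doubling_time :
    ∃ C : ℝ, 0 < C ∧ ∀ (ν T : ℝ), 0 < ν → 0 < T →
      ∀ (u : ℝ → EuclideanSpace ℝ (Fin 3) → EuclideanSpace ℝ (Fin 3)) (p : ℝ → EuclideanSpace ℝ (Fin 3) → ℝ),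
      IsMaximalSmoothSolution ν 0 u p T → IsLerayHopfOn T ν 0 (u 0) u →
      ∀ a ∈ Ioo 0 T, ∀ V : ℝ, 0 < V → (∀ y, ‖u a y‖ ≤ V) →
      ∀ t ∈ Ico a T, C * V ^ 2 * (t - a) < ν → ∀ x, ‖u t x‖ ≤ 2 * V := by
  obtain ⟨C₁, hC₁, H⟩ := exists_norm_le_two_mul_of_window
  refine ⟨64 * C₁ ^ 2, by positivity, fun ν T hν hT u p hmax hLH a ha V hV hVa t ht htw x => ?_⟩
  rcases ht.1.eq_or_lt with hat | hat
  · subst hat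
    exact (hVa x).trans (by linarith)
  -- the translate on the closed slab `[0, t - a]`
  have hta : 0 < t - a := sub_pos.2 hat
  have hcl : IsClassicalNSSolutionOn (Icc 0 (t - a)) ν 0 (fun s => u (s + a)) (fun s => p (s + a)) := by
    have hpre : Icc 0 (t - a) ⊆ (· + a) ⁻¹' Ico 0 T := fun s hs =>
      ⟨by simp only [mem_Icc] at hs; linarith [hs.1, ha.1], by simp only [mem_Icc] at hs; linarith [hs.2, ht.2]⟩
    exact (hmax.1.comp_add_right a).mono hpre (uniqueDiffOn_Icc hta)
  have hLHa : IsLerayHopfOn (t - a) ν 0 ((fun s => u (s + a)) 0) (fun s => u (s + a)) := by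
    simpa only [zero_add] using isLerayHopfOn_translate hν hT hmax.1 hLH ha (T₂ := t) ⟨hat, ht.2⟩
  -- boundedness on `[a, t] × ℝ³`
  obtain ⟨M, hM⟩ := exists_bound_window hν hT hmax.1 hLH ha.1 (T' := t) ht.2
  have hMb : ∀ s ∈ Icc 0 (t - a), ∀ y, ‖(fun s => u (s + a)) s y‖ ≤ max M 1 := fun s hs y =>
    (hM (s + a) ⟨by linarith [hs.1], by linarith [hs.2]⟩ y).trans (le_max_left _ _)
  have hMpos : 0 < max M 1 := lt_of_lt_of_le one_pos (le_max_right _ _)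
  have hVa' : ∀ y, ‖(fun s => u (s + a)) 0 y‖ ≤ V := fun y => by simpa only [zero_add] using hVa y
  have h := H hν hta hcl hLHa hMpos hMb hV hVa' (t - a) ⟨hta, le_rfl⟩ (by linarith [htw]) x
  simpa only [sub_add_cancel] using h

/-- **L25 with `V = ‖u(a)‖_∞`.** Along every maximal smooth Leray–Hopf solution, for `a ∈ (0, T)` with
`0 < ‖u(a)‖_∞ < ∞`: for all `t ∈ [a, T)` with `C ‖u(a)‖_∞² (t − a) < ν` and all `x`, `‖u(t, x)‖ ≤ 2‖u(a)‖_∞`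
(the continuous slice `u(a)` is pointwise bounded by its essential supremum). [cite: Leray1934, §21 (3.14)–(3.15) p. 226] -/
theorem sup_doubling_time_eLpNorm :
    ∃ C : ℝ, 0 < C ∧ ∀ (ν T : ℝ), 0 < ν → 0 < T →
      ∀ (u : ℝ → EuclideanSpace ℝ (Fin 3) → EuclideanSpace ℝ (Fin 3)) (p : ℝ → EuclideanSpace ℝ (Fin 3) → ℝ),
      IsMaximalSmoothSolution ν 0 u p T → IsLerayHopfOn T ν 0 (u 0) u →
      ∀ a ∈ Ioo 0 T, eLpNorm (u a) ∞ volume ≠ ⊤ → 0 < (eLpNorm (u a) ∞ volume).toReal →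
      ∀ t ∈ Ico a T, C * (eLpNorm (u a) ∞ volume).toReal ^ 2 * (t - a) < ν →
        ∀ x, ‖u t x‖ ≤ 2 * (eLpNorm (u a) ∞ volume).toReal := by
  obtain ⟨C, hC, H⟩ := sup_doubling_time
  refine ⟨C, hC, fun ν T hν hT u p hmax hLH a ha htop hpos t ht htw x => ?_⟩
  refine H ν T hν hT u p hmax hLH a ha _ hpos (fun y => ?_) t ht htw x
  -- pointwise bound of the continuous slice by its essential supremum
  have hcont : Continuous (u a) := (hmax.1.contDiff_velocity ⟨ha.1.le, ha.2⟩).continuous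
  have hae : ∀ᵐ y ∂volume, ‖u a y‖ ≤ (eLpNorm (u a) ∞ volume).toReal := by
    have h1 := ae_le_eLpNormEssSup (f := u a) (μ := volume)
    filter_upwards [h1] with y hy
    rw [← eLpNorm_exponent_top] at hy
    have := ENNReal.toReal_mono htop hy
    rwa [toReal_enorm] at this
  exact forall_norm_le_of_ae_norm_le hcont hae y

/-! ## Iterating the doubling time: `k` doublings cost at least `(4/3)(1 − 4^{−k}) ν/(C V²)` -/

/-- **L25′ — `k` DOUBLINGS OF THE MAXIMUM SPEED COST AT LEAST `(4/3)(1 − 4^{−k}) · ν/(C V²)`.** With the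
constant `C` of `sup_doubling_time`: along every maximal smooth Leray–Hopf solution of the unforced system
(`ν > 0`), for every `a ∈ (0, T)`, every `V > 0` with `‖u(a, y)‖ ≤ V` for all `y`, and every `k : ℕ`:
`‖u(b, x)‖ ≤ 2^k V` for all `x` and all `b ∈ [a, T)` with `C V² (b − a) < ν · (4/3) · (1 − (4^k)⁻¹)`. The
windows of `sup_doubling_time` at amplitudes `V, 2V, 4V, …` have lengths `ν/(CV²) · (1, 1/4, 1/16, …)`: a
geometric series with sum `(4/3) ν/(C V²)` — the discrete inverse-square law of the amplitude currency (the sup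
norm cannot outrun `V(t) = V/√(1 − t/τ)`-type growth by more than the factor `2` per window), and the sup clock
L21 again: the maximum speed cannot blow up before `a + 4ν/(3 C V²)`. Induction on `k`, peeling the LAST window.
[cite: Leray1934, §21 (3.14)–(3.15) p. 226] [cite: OzanskiPooley2018, Lemma 6.23 (i)] -/
theorem sup_doublings :
    ∃ C : ℝ, 0 < C ∧ ∀ (ν T : ℝ), 0 < ν → 0 < T →
      ∀ (u : ℝ → EuclideanSpace ℝ (Fin 3) → EuclideanSpace ℝ (Fin 3)) (p : ℝ → EuclideanSpace ℝ (Fin 3) → ℝ),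
      IsMaximalSmoothSolution ν 0 u p T → IsLerayHopfOn T ν 0 (u 0) u →
      ∀ a ∈ Ioo 0 T, ∀ V : ℝ, 0 < V → (∀ y, ‖u a y‖ ≤ V) →
      ∀ (k : ℕ), ∀ b ∈ Ico a T, C * V ^ 2 * (b - a) < ν * (4 / 3) * (1 - ((4 : ℝ) ^ k)⁻¹) →
        ∀ x, ‖u b x‖ ≤ 2 ^ k * V := by
  obtain ⟨C, hC, H⟩ := sup_doubling_time
  refine ⟨C, hC, fun ν T hν hT u p hmax hLH a ha V hV hVa k => ?_⟩
  induction k with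
  | zero =>
    intro b hb hlt x
    -- the hypothesis is `C V² (b - a) < 0`: impossible
    have h0 : 0 ≤ C * V ^ 2 * (b - a) := by
      have : 0 ≤ b - a := sub_nonneg.2 hb.1
      positivity
    simp only [pow_zero, inv_one, sub_self, mul_zero] at hlt
    linarith
  | succ k ih =>
    intro b hb hlt x
    have h4k : 0 < (4 : ℝ) ^ k := by positivity
    have hV2k : 0 < 2 ^ k * V := by positivity
    have hVa' : ∀ y, ‖u a y‖ ≤ 2 ^ k * V := fun y =>
      (hVa y).trans (le_mul_of_one_le_left hV.le (one_le_pow₀ (by norm_num)))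
    have h22 : (2 ^ k * V) ^ 2 = 4 ^ k * V ^ 2 := by
      rw [mul_pow, ← pow_mul, show k * 2 = 2 * k by ring, pow_mul]
      norm_num
    -- the slack `ε` of the hypothesis
    set W : ℝ := ν * (4 / 3) * (1 - ((4 : ℝ) ^ (k + 1))⁻¹) with hW
    set ε : ℝ := W - C * V ^ 2 * (b - a) with hε
    have hε0 : 0 < ε := by rw [hε]; linarith
    have hWle : W ≤ ν * (4 / 3) := by
      have : 0 ≤ ((4 : ℝ) ^ (k + 1))⁻¹ := by positivity
      rw [hW]
      nlinarith
    have hba0 : 0 ≤ C * V ^ 2 * (b - a) := by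
      have : 0 ≤ b - a := sub_nonneg.2 hb.1
      positivity
    have hεν : ε / 2 < ν := by
      have : ε ≤ W := by rw [hε]; linarith
      linarith
    -- the identity `W - ν 4^{-k} = ν (4/3) (1 - 4^{-k})`
    have hWk : W - ν * ((4 : ℝ) ^ k)⁻¹ = ν * (4 / 3) * (1 - ((4 : ℝ) ^ k)⁻¹) := by
      rw [hW, pow_succ]
      field_simp
      ring
    by_cases hA : C * (2 ^ k * V) ^ 2 * (b - a) < ν
    · -- Case A: `b` lies in the first window at amplitude `2^k V` from `a`
      have h := H ν T hν hT u p hmax hLH a ha (2 ^ k * V) hV2k hVa' b hb hA x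
      calc ‖u b x‖ ≤ 2 * (2 ^ k * V) := h
        _ = 2 ^ (k + 1) * V := by rw [pow_succ]; ring
    · -- Case B: peel the last window `[t, b]`, `C 4^k V² (b - t) = ν - ε/2`
      rw [not_lt, h22] at hA
      have hCV : 0 < C * 4 ^ k * V ^ 2 := by positivity
      set t : ℝ := b - (ν - ε / 2) / (C * 4 ^ k * V ^ 2) with ht
      have hbt : C * 4 ^ k * V ^ 2 * (b - t) = ν - ε / 2 := by
        rw [ht]
        field_simp
        ring
      have hat : a ≤ t := by
        -- `b - a ≥ ν/(C 4^k V²) ≥ (ν - ε/2)/(C 4^k V²)`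
        have h1 : (ν - ε / 2) / (C * 4 ^ k * V ^ 2) ≤ b - a := by
          rw [div_le_iff₀ hCV]
          nlinarith [hA, hε0.le]
        rw [ht]
        linarith
      have htb : t ≤ b := by
        have : 0 ≤ (ν - ε / 2) / (C * 4 ^ k * V ^ 2) := div_nonneg (by linarith) hCV.le
        rw [ht]
        linarith
      have htI : t ∈ Ico a T := ⟨hat, htb.trans_lt hb.2⟩
      have htI' : t ∈ Ioo 0 T := ⟨ha.1.trans_le hat, htb.trans_lt hb.2⟩
      -- the induction hypothesis at `t`
      have hih : C * V ^ 2 * (t - a) < ν * (4 / 3) * (1 - ((4 : ℝ) ^ k)⁻¹) := by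
        have h1 : C * V ^ 2 * (t - a) = C * V ^ 2 * (b - a) - (ν - ε / 2) * ((4 : ℝ) ^ k)⁻¹ := by
          have h2 : C * V ^ 2 * (b - t) = (ν - ε / 2) * ((4 : ℝ) ^ k)⁻¹ := by
            have h3 : C * V ^ 2 * (b - t) * 4 ^ k = ν - ε / 2 := by rw [← hbt]; ring
            rw [← h3]
            field_simp
          linarith [h2]
        have h4inv : ((4 : ℝ) ^ k)⁻¹ ≤ 1 := inv_le_one_of_one_le₀ (one_le_pow₀ (by norm_num))
        have h4inv0 : 0 < ((4 : ℝ) ^ k)⁻¹ := by positivity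
        rw [h1, ← hWk]
        -- `C V²(b-a) - (ν - ε/2) 4^{-k} = W - ε - ν 4^{-k} + (ε/2) 4^{-k} < W - ν 4^{-k}`
        nlinarith [hε0, h4inv, h4inv0]
      have hut : ∀ y, ‖u t y‖ ≤ 2 ^ k * V := fun y => ih t htI hih y
      -- the last window from `t` at amplitude `2^k V`
      have hwin : C * (2 ^ k * V) ^ 2 * (b - t) < ν := by
        rw [h22, show C * (4 ^ k * V ^ 2) * (b - t) = C * 4 ^ k * V ^ 2 * (b - t) by ring, hbt]
        linarith
      have h := H ν T hν hT u p hmax hLH t htI' (2 ^ k * V) hV2k hut b ⟨htb, hb.2⟩ hwin x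
      calc ‖u b x‖ ≤ 2 * (2 ^ k * V) := h
        _ = 2 ^ (k + 1) * V := by rw [pow_succ]; ring

/-! ## The sup clock from the doubling time, with the same constant -/

/-- **L25″ — NO BLOW-UP WITHIN `4ν/(3 C V²)` OF AN INSTANT WHERE THE MAXIMUM SPEED IS `≤ V`.** With the constant
`C` of `sup_doubling_time`: along every maximal smooth Leray–Hopf solution of the unforced system (`ν > 0`), for
every `a ∈ (0, T)` and every `V > 0` with `‖u(a, y)‖ ≤ V` for all `y`: `4 ν ≤ 3 C V² (T − a)` — the sup clock
(L21) in pointwise form with the doubling-time constant, proved from `sup_doublings` alone: were `T − a` shorter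
than the `k`-doubling time, `u` would be bounded on `(a, T) × ℝ³`, hence `H¹`-regular on `(0, T]`
(`IsLerayHopfOn.isH1RegularOn_Ioc_of_ae_bound_window`) and would extend past `T`
(`hasSmoothExtensionPast_of_isH1RegularOn_Ioc`); then `k → ∞`. For a DNS reader: a run whose maximum speed is
`V` at time `a` is at least `4ν/(3CV²)` away from any blow-up. [cite: Leray1934, §19 (3.8)–(3.9) p. 224]
[cite: OzanskiPooley2018, Cor. 6.25 with Thm. 6.22] -/
theorem no_blowup_within :
    ∃ C : ℝ, 0 < C ∧ ∀ (ν T : ℝ), 0 < ν → 0 < T →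
      ∀ (u : ℝ → EuclideanSpace ℝ (Fin 3) → EuclideanSpace ℝ (Fin 3)) (p : ℝ → EuclideanSpace ℝ (Fin 3) → ℝ),
      IsMaximalSmoothSolution ν 0 u p T → IsLerayHopfOn T ν 0 (u 0) u →
      ∀ a ∈ Ioo 0 T, ∀ V : ℝ, 0 < V → (∀ y, ‖u a y‖ ≤ V) → 4 * ν ≤ 3 * C * V ^ 2 * (T - a) := by
  obtain ⟨C, hC, H⟩ := sup_doublings
  refine ⟨C, hC, fun ν T hν hT u p hmax hLH a ha V hV hVa => ?_⟩
  -- Step 1: for every `k`, the `k`-doubling time fits before `T`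
  have hk : ∀ k : ℕ, ν * (4 / 3) * (1 - ((4 : ℝ) ^ k)⁻¹) ≤ C * V ^ 2 * (T - a) := by
    intro k
    by_contra hlt
    rw [not_le] at hlt
    -- then `u` is bounded by `2^k V` on `[a, T) × ℝ³`
    have hbd : ∀ t ∈ Ioo a T, ∀ᵐ x ∂volume, ‖u t x‖ ≤ 2 ^ k * V := by
      intro t ht
      refine ae_of_all _ fun x => H ν T hν hT u p hmax hLH a ha V hV hVa k t ⟨ht.1.le, ht.2⟩ ?_ x
      have hTt : t - a ≤ T - a := by linarith [ht.2]
      calc C * V ^ 2 * (t - a) ≤ C * V ^ 2 * (T - a) := mul_le_mul_of_nonneg_left hTt (by positivity)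
        _ < _ := hlt
    -- hence `H¹`-regular on `(0, T]`, and extends past `T`: contradiction
    have hregW : IsH1RegularOn (Ioc a T) u := hLH.isH1RegularOn_Ioc_of_ae_bound_window hν ha.1.le le_rfl hbd
    have hreg0 : IsH1RegularOn (Ioo 0 T) u := hmax.isH1RegularOn_Ioo hν hT hLH
    have hregT : IsH1RegularOn (Ioc 0 T) u := by
      refine ⟨fun t ht => ?_, fun t ht => ?_⟩
      · rcases lt_or_ge a t with hat | hat
        · exact hregW.1 t ⟨hat, ht.2⟩
        · exact hreg0.1 t ⟨ht.1, hat.trans_lt ha.2⟩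
      · rcases lt_or_ge a t with hat | hat
        · exact (hregW.2 t ⟨hat, ht.2⟩).mono_of_mem_nhdsWithin
            (mem_nhdsWithin_iff_exists_mem_nhds_inter.2 ⟨Ioi a, Ioi_mem_nhds hat, fun s hs => ⟨hs.1, hs.2.2⟩⟩)
        · have htT : t < T := hat.trans_lt ha.2
          exact (hreg0.2 t ⟨ht.1, htT⟩).mono_of_mem_nhdsWithin
            (mem_nhdsWithin_of_mem_nhds (Ioo_mem_nhds ht.1 htT))
    exact hmax.2 (hmax.1.hasSmoothExtensionPast_of_isH1RegularOn_Ioc hν hT hLH hregT)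
  -- Step 2: `k → ∞`
  have hlim : Tendsto (fun k : ℕ => ν * (4 / 3) * (1 - ((4 : ℝ) ^ k)⁻¹)) atTop (𝓝 (ν * (4 / 3) * (1 - 0))) :=
    ((tendsto_inv_atTop_zero.comp (tendsto_pow_atTop_atTop_of_one_lt (by norm_num : (1 : ℝ) < 4))).const_sub
      1).const_mul _
  have h := le_of_tendsto' hlim hk
  linarith

end Summit.NavierStokesRegularity.FluidComputer.LeraySupDoubling

end
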